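import Summits.QuantumFields.YangMills.Theorems.SmallCircleAnchorAnchorGapGaussianCovBlockFactor
import Summits.QuantumFields.YangMills.Theorems.SmallCircleAnchorAnchorGapCovFullPtPosDef
import Summits.QuantumFields.YangMills.Theorems.SmallCircleAnchorAnchorGapBBFPeelingAnalytic

/-!
# Crux `AnchorGap` (stmt-QuantumFields-11141), line `registered` — GREP's pair-interpolated covariance
# at a DECOUPLED point: block structure and factorisation of the peeled expectation (step (G3))

At the decoupled interpolation point `σ_s(t)` of a valid script `s` with point set `Y`, GREP's
covariance `cov X σ_s` (`stub_gaussianBBFPolymerRep`) has no entries between the atoms of `Y` and the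
other atoms (lit ✓`Script.decPt_mk_of_mem_of_notMem`), and on the atoms off `Y` it IS the
un-interpolated covariance `cov (X ∖ Y) 1` of the complement (lit ✓`Script.decPt_mk_of_notMem`); so by
✓FACT (`stub_gaussianCovBlockFactor`) the normalised expectation of a product `F · G` — `F` seeing the
atoms of `Y`, `G` the others — factorises as `E(cov X σ_s)(F) · E(cov (X ∖ Y) 1)(G)`: the inside
factor is GREP's activity integrand, the outside factor is the SAME PROBLEM ON THE COMPLEMENT, which
the atom-resolved recursion ✓`AtomGas.polymerPartitionFunction_atom_recursion` (p790535) consumes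
(LOCATE-GREP (G3), evidence on stmt-QuantumFields-11141).  [folklore]; no definition, no named fact.

* `posDef_cov_decPt` — `cov X σ_s(t)` is positive definite for `t ∈ [0,1]^β` (`σ_s(t) = ρ_s(t[y_k:=0])`,
  ✓`BBFPeel.eval_decPt_eq_update_zero`, ✓`FullPt.posDef_cov_fullPt`);
* `posDef_cov_one` — so is the un-interpolated `cov X' 1` (GRAM with one common unit vector);
* `cov_decPt_cross_eq_zero`, `cov_decPt_eq_cov_one`, `cov_one_cross_eq_zero` — the block pattern;
* `gaussExpect_decPt_mul_eq` — **the factorisation**.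
-/

set_option autoImplicit false

namespace Summit.QuantumFields.YangMills.Theorems.AnchorGap.DecPt

open Finset MvPolynomial MeasureTheory Literature.Probability.LatticeModels
  Literature.Probability.LatticeModels.BattleFederbush Literature.MeasureTheory.Integral
open scoped InnerProductSpace Matrix

variable {ι β : Type} [Fintype ι] [DecidableEq ι] [Fintype β] [DecidableEq β] {r : β} {k : ℕ}

/-- **`cov X σ_s(t)` is positive definite** (`t ∈ [0,1]^β`): the decoupled point is the full point at
`t[y_k := 0]`. [folklore] -/
theorem posDef_cov_decPt (blk : ι → β) (C : Matrix ι ι ℝ) (hC : C.PosDef) (X : Finset β)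
    (s : Script r k) (hs : s.Valid) {t : β → ℝ} (ht : t ∈ unitCube β) :
    (Matrix.of fun i j : ι => (if blk i = blk j then 1 else if blk i ∈ X ∧ blk j ∈ X
      then eval t (Script.decPt ℝ s s(blk i, blk j)) else 0) * C i j).PosDef := by
  have h := FullPt.posDef_cov_fullPt_of_mem_unitCube ι blk C hC X s hs
    (BBFPeel.update_mem_unitCube ht (s.y (Fin.last k)) ⟨le_rfl, zero_le_one⟩)
  have heq : (Matrix.of fun i j : ι => (if blk i = blk j then 1 else if blk i ∈ X ∧ blk j ∈ X
      then eval t (Script.decPt ℝ s s(blk i, blk j)) else 0) * C i j)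
      = Matrix.of fun i j : ι => (if blk i = blk j then 1 else if blk i ∈ X ∧ blk j ∈ X
        then eval (Function.update t (s.y (Fin.last k)) 0) (Script.fullPt ℝ s s(blk i, blk j)) else 0)
          * C i j := by
    ext i j
    simp only [Matrix.of_apply, BBFPeel.eval_decPt_eq_update_zero s hs t]
  rw [heq]
  exact h

/-- **The un-interpolated covariance `cov X' 1` is positive definite**: its factors
`(blk i = blk j ? 1 : blk i, blk j ∈ X' ? 1 : 0)` are the inner products of the unit vectors `e₀`
(atoms of `X'`) and `e_{1+a}` (atoms off `X'`). [folklore] -/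
theorem posDef_cov_one (blk : ι → β) (C : Matrix ι ι ℝ) (hC : C.PosDef) (X' : Finset β) :
    (Matrix.of fun i j : ι => (if blk i = blk j then 1 else if blk i ∈ X' ∧ blk j ∈ X'
      then (1 : ℝ) else 0) * C i j).PosDef := by
  classical
  set N : ℕ := 1 + Fintype.card β with hN
  set e := Fintype.equivFin β with he
  set u : β → EuclideanSpace ℝ (Fin N) := fun a => if a ∈ X' then stdVec N 0 else stdVec N (1 + e a)
    with hudef
  have heN : ∀ a, 1 + (e a : ℕ) < N := fun a => by have := (e a).isLt; omega
  have hu : ∀ a, ‖u a‖ = 1 := by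
    intro a
    simp only [hudef]
    split_ifs
    · exact norm_stdVec (by omega)
    · exact norm_stdVec (heN a)
  have hfac : ∀ a b, ⟪u a, u b⟫_ℝ
      = (if a = b then 1 else if a ∈ X' ∧ b ∈ X' then (1 : ℝ) else 0) := by
    intro a b
    by_cases hab : a = b
    · subst hab
      rw [if_pos rfl, real_inner_self_eq_norm_sq, hu, one_pow]
    rw [if_neg hab]
    by_cases ha : a ∈ X' <;> by_cases hb : b ∈ X'
    · simp only [hudef, if_pos ha, if_pos hb, if_pos (And.intro ha hb)]
      rw [inner_stdVec_stdVec, if_pos ⟨rfl, by omega⟩]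
    · simp only [hudef, if_pos ha, if_neg hb, hb, and_false, if_false]
      rw [inner_stdVec_stdVec, if_neg]; omega
    · simp only [hudef, if_neg ha, if_pos hb, ha, false_and, if_false]
      rw [inner_stdVec_stdVec, if_neg]; omega
    · simp only [hudef, if_neg ha, if_neg hb, ha, false_and, if_false]
      rw [inner_stdVec_stdVec, if_neg]
      rintro ⟨h, -⟩
      exact hab (e.injective (Fin.ext (by omega)))
  have hM : (Matrix.of fun i j : ι => (if blk i = blk j then 1 else if blk i ∈ X' ∧ blk j ∈ X'
        then (1 : ℝ) else 0) * C i j) = Matrix.of fun i j : ι => ⟪u (blk i), u (blk j)⟫_ℝ * C i j := by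
    ext i j
    simp only [Matrix.of_apply]
    rw [hfac]
  rw [hM]
  exact stub_gramHadamardPosDef ι β blk C hC N u hu

omit [DecidableEq ι] [Fintype β] in
/-- **No entries between the atoms of the script and the others** at the decoupled point. [folklore] -/
theorem cov_decPt_cross_eq_zero (blk : ι → β) (C : Matrix ι ι ℝ) (X : Finset β) (s : Script r k)
    (t : β → ℝ) (i j : ι)
    (hij : ¬ (i ∈ univ.filter (fun i => blk i ∈ univ.image s.y) ↔ j ∈ univ.filter (fun i => blk i ∈ univ.image s.y))) :
    (if blk i = blk j then 1 else if blk i ∈ X ∧ blk j ∈ X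
      then eval t (Script.decPt ℝ s s(blk i, blk j)) else 0) * C i j = 0 := by
  simp only [mem_filter, mem_univ, true_and] at hij
  have hne : blk i ≠ blk j := fun h => hij (by rw [h])
  rw [if_neg hne]
  by_cases hX : blk i ∈ X ∧ blk j ∈ X
  · rw [if_pos hX]
    by_cases hi : blk i ∈ univ.image s.y
    · have hj : blk j ∉ univ.image s.y := fun hj => hij ⟨fun _ => hj, fun _ => hi⟩
      rw [Script.decPt_mk_of_mem_of_notMem (R := ℝ) s hi hj, map_zero, zero_mul]
    · have hj : blk j ∈ univ.image s.y := by
        by_contra hj; exact hij ⟨fun h => absurd h hi, fun h => absurd h hj⟩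
      rw [Sym2.eq_swap, Script.decPt_mk_of_mem_of_notMem (R := ℝ) s hj hi, map_zero, zero_mul]
  · rw [if_neg hX, zero_mul]

omit [Fintype ι] [DecidableEq ι] [Fintype β] in
/-- **On the atoms off the script, `cov X σ_s = cov (X ∖ Y) 1`** (pairs of two outside atoms are not
interpolated). [folklore] -/
theorem cov_decPt_eq_cov_one (blk : ι → β) (C : Matrix ι ι ℝ) (X : Finset β) (s : Script r k)
    (t : β → ℝ) (i j : ι) (hi : blk i ∉ univ.image s.y) (hj : blk j ∉ univ.image s.y) :
    (if blk i = blk j then 1 else if blk i ∈ X ∧ blk j ∈ X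
      then eval t (Script.decPt ℝ s s(blk i, blk j)) else 0) * C i j
      = (if blk i = blk j then 1 else if blk i ∈ X \ univ.image s.y ∧ blk j ∈ X \ univ.image s.y
        then (1 : ℝ) else 0) * C i j := by
  by_cases h : blk i = blk j
  · rw [if_pos h, if_pos h]
  · rw [if_neg h, if_neg h]
    simp only [mem_sdiff, hi, hj, not_false_eq_true, and_true]
    by_cases hX : blk i ∈ X ∧ blk j ∈ X
    · rw [if_pos hX, if_pos hX, Script.decPt_mk_of_notMem (R := ℝ) s hi hj, map_one]
    · rw [if_neg hX, if_neg hX]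

omit [DecidableEq ι] [Fintype β] in
/-- The un-interpolated covariance of the complement has no entries between the atoms of the script
and the others either. [folklore] -/
theorem cov_one_cross_eq_zero (blk : ι → β) (C : Matrix ι ι ℝ) (X : Finset β) (s : Script r k)
    (i j : ι)
    (hij : ¬ (i ∈ univ.filter (fun i => blk i ∉ univ.image s.y) ↔ j ∈ univ.filter (fun i => blk i ∉ univ.image s.y))) :
    (if blk i = blk j then 1 else if blk i ∈ X \ univ.image s.y ∧ blk j ∈ X \ univ.image s.y
      then (1 : ℝ) else 0) * C i j = 0 := by
  simp only [mem_filter, mem_univ, true_and] at hij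
  have hne : blk i ≠ blk j := fun h => hij (by rw [h])
  rw [if_neg hne, if_neg, zero_mul]
  rintro ⟨hi, hj⟩
  exact hij ⟨fun _ => (mem_sdiff.1 hj).2, fun _ => (mem_sdiff.1 hi).2⟩

/-- **Factorisation of the peeled expectation at a decoupled point.** For a valid script `s` with point
set `Y`, `t ∈ [0,1]^β`, `F` depending only on the field at the atoms of `Y` and `G` only on the field at
the other atoms:
`E(cov X σ_s(t))(F·G) = E(cov X σ_s(t))(F) · E(cov (X ∖ Y) 1)(G)`
(`E Cv H = ∫ H e^{−½φᵀCv⁻¹φ} ∕ ∫ e^{−½φᵀCv⁻¹φ}` as in GREP; ✓FACT twice and the block pattern above).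
[folklore] -/
theorem gaussExpect_decPt_mul_eq (blk : ι → β) (C : Matrix ι ι ℝ) (hC : C.PosDef) (X : Finset β)
    (s : Script r k) (hs : s.Valid) {t : β → ℝ} (ht : t ∈ unitCube β) (F G : (ι → ℝ) → ℝ)
    (hF : ∀ φ ψ : ι → ℝ, (∀ i, blk i ∈ univ.image s.y → φ i = ψ i) → F φ = F ψ)
    (hG : ∀ φ ψ : ι → ℝ, (∀ i, blk i ∉ univ.image s.y → φ i = ψ i) → G φ = G ψ) :
    (∫ φ : ι → ℝ, F φ * G φ * Real.exp (-(φ ⬝ᵥ ((Matrix.of fun i j : ι => (if blk i = blk j then 1 else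
        if blk i ∈ X ∧ blk j ∈ X then eval t (Script.decPt ℝ s s(blk i, blk j)) else 0) * C i j)⁻¹ *ᵥ φ)) / 2))
      / (∫ φ : ι → ℝ, Real.exp (-(φ ⬝ᵥ ((Matrix.of fun i j : ι => (if blk i = blk j then 1 else
        if blk i ∈ X ∧ blk j ∈ X then eval t (Script.decPt ℝ s s(blk i, blk j)) else 0) * C i j)⁻¹ *ᵥ φ)) / 2))
    = ((∫ φ : ι → ℝ, F φ * Real.exp (-(φ ⬝ᵥ ((Matrix.of fun i j : ι => (if blk i = blk j then 1 else
        if blk i ∈ X ∧ blk j ∈ X then eval t (Script.decPt ℝ s s(blk i, blk j)) else 0) * C i j)⁻¹ *ᵥ φ)) / 2))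
      / ∫ φ : ι → ℝ, Real.exp (-(φ ⬝ᵥ ((Matrix.of fun i j : ι => (if blk i = blk j then 1 else
        if blk i ∈ X ∧ blk j ∈ X then eval t (Script.decPt ℝ s s(blk i, blk j)) else 0) * C i j)⁻¹ *ᵥ φ)) / 2))
    * ((∫ φ : ι → ℝ, G φ * Real.exp (-(φ ⬝ᵥ ((Matrix.of fun i j : ι => (if blk i = blk j then 1 else
        if blk i ∈ X \ univ.image s.y ∧ blk j ∈ X \ univ.image s.y then (1 : ℝ) else 0) * C i j)⁻¹ *ᵥ φ)) / 2))
      / ∫ φ : ι → ℝ, Real.exp (-(φ ⬝ᵥ ((Matrix.of fun i j : ι => (if blk i = blk j then 1 else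
        if blk i ∈ X \ univ.image s.y ∧ blk j ∈ X \ univ.image s.y then (1 : ℝ) else 0) * C i j)⁻¹ *ᵥ φ)) / 2)) := by
  classical
  set M : Matrix ι ι ℝ := Matrix.of fun i j : ι => (if blk i = blk j then 1 else
    if blk i ∈ X ∧ blk j ∈ X then eval t (Script.decPt ℝ s s(blk i, blk j)) else 0) * C i j with hMdef
  set M1 : Matrix ι ι ℝ := Matrix.of fun i j : ι => (if blk i = blk j then 1 else
    if blk i ∈ X \ univ.image s.y ∧ blk j ∈ X \ univ.image s.y then (1 : ℝ) else 0) * C i j with hM1def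
  set S : Finset ι := univ.filter fun i => blk i ∈ univ.image s.y with hSdef
  set S' : Finset ι := univ.filter fun i => blk i ∉ univ.image s.y with hS'def
  have hMpd : M.PosDef := posDef_cov_decPt blk C hC X s hs ht
  have hM1pd : M1.PosDef := posDef_cov_one blk C hC (X \ univ.image s.y)
  have hMz : ∀ i j : ι, ¬ (i ∈ S ↔ j ∈ S) → M i j = 0 := fun i j hij => by
    simp only [hMdef, Matrix.of_apply]; exact cov_decPt_cross_eq_zero blk C X s t i j hij
  have hMz' : ∀ i j : ι, ¬ (i ∈ S' ↔ j ∈ S') → M i j = 0 := fun i j hij => by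
    refine hMz i j fun h => hij ?_
    simp only [hSdef, hS'def, mem_filter, mem_univ, true_and] at h ⊢
    constructor
    · intro hi hj; exact hi (h.2 hj)
    · intro hj hi; exact hj (h.1 hi)
  have hM1z' : ∀ i j : ι, ¬ (i ∈ S' ↔ j ∈ S') → M1 i j = 0 := fun i j hij => by
    simp only [hM1def, Matrix.of_apply]; exact cov_one_cross_eq_zero blk C X s i j hij
  have hFS : ∀ φ ψ : ι → ℝ, (∀ i ∈ S, φ i = ψ i) → F φ = F ψ := fun φ ψ h =>
    hF φ ψ fun i hi => h i (by simpa [hSdef] using hi)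
  have hGS : ∀ φ ψ : ι → ℝ, (∀ i, i ∉ S → φ i = ψ i) → G φ = G ψ := fun φ ψ h =>
    hG φ ψ fun i hi => h i (by simpa [hSdef] using hi)
  have hGS' : ∀ φ ψ : ι → ℝ, (∀ i ∈ S', φ i = ψ i) → G φ = G ψ := fun φ ψ h =>
    hG φ ψ fun i hi => h i (by simpa [hS'def] using hi)
  -- FACT on `M` across `S`: product rule
  have h1 := (stub_gaussianCovBlockFactor ι M hMpd S hMz F G hFS hGS).1
  -- FACT marginals of `G` across `S'` for `M` and `M1`
  have h2 := (stub_gaussianCovBlockFactor ι M hMpd S' hMz' G (fun _ => 1) hGS' (fun _ _ _ => rfl)).2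
  have h3 := (stub_gaussianCovBlockFactor ι M1 hM1pd S' hM1z' G (fun _ => 1) hGS' (fun _ _ _ => rfl)).2
  have hsub : M.submatrix (Subtype.val : {i // i ∈ S'} → ι) (Subtype.val : {i // i ∈ S'} → ι)
      = M1.submatrix (Subtype.val : {i // i ∈ S'} → ι) (Subtype.val : {i // i ∈ S'} → ι) := by
    ext a b
    simp only [Matrix.submatrix_apply, hMdef, hM1def, Matrix.of_apply]
    have ha : blk a.1 ∉ univ.image s.y := by simpa [hS'def] using a.2
    have hb : blk b.1 ∉ univ.image s.y := by simpa [hS'def] using b.2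
    exact cov_decPt_eq_cov_one blk C X s t a.1 b.1 ha hb
  rw [hsub] at h2
  rw [h1, h2, ← h3]

end Summit.QuantumFields.YangMills.Theorems.AnchorGap.DecPt
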